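import Summits.ValiantsHypothesis.ValiantsHypothesis.Theorems.BarrierLeverSuccinctHittingSetsForVPIdealWindow
import Literature.Barriers.ValiantsHypothesis.AlgebraicNaturalProofsKI

/-!
# Crux `BarrierLever.SuccinctHittingSetsForVP` (stmt-ValiantsHypothesis-14610) — every Kabanets–Impagliazzo
# design generator is RECONSTRUCTIBLE; hence the equation edge of the window applies to all of them

The two-line bridge asked for by the cell planner `valiant-natproofs-p2` (gen 2, OPEN item O3): the
tree's unconditional KI engine (`complexity_le_of_kiGenerator_annihilated`,
`Literature/Computability/AlgebraicComplexity/KabanetsImpagliazzoHardness.lean`, via the root closure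
`RootLifting.lean`) says exactly that `KI-gen(f)` over an `r`-design is `Reconstructible` with base
complexity `L(f)` and the KI threshold `kiThreshold`; so `…IdealWindow.not_succinct_smallCircuits_of_overplanted`
yields, for EVERY design `e` and EVERY base polynomial `f` (not only KRST's Reed–Solomon design and the
permanent): if `f` is harder than the KI threshold at the class's own equation level
(`2^{n^{c(b)}}`, `n^{c(b)}`), then `KI-gen(f)` is NOT per-seed `SmallCircuits ℂ n b`-succinct
(`kiGenerator_not_succinct_of_overplanted`). Unconditional; does NOT close the item (cell
`valiant-natproofs`, V4, D-0053: the per-seed succinctness door is open only inside the window).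

WHAT THIS IS NOT: not a lower bound; says nothing about generators that are not of Kabanets–Impagliazzo
design type.

References: [KabanetsImpagliazzo2003] Lemma 30; [KumarRamyaSaptharishiTengse2022] Lemma 8;
[ForbesShpilkaVolk2018] Def. 7.
-/

-- layout Summits/ValiantsHypothesis/ValiantsHypothesis forces the duplicated namespace component
set_option linter.dupNamespace false

noncomputable section

namespace Summit.ValiantsHypothesis.ValiantsHypothesis.Theorems.BarrierLever.SuccinctHittingSetsForVP

namespace IdealWindow

open Literature.Barriers.ValiantsHypothesis Literature.Computability.AlgebraicComplexity
  Literature.Computability.MetaComplexity MvPolynomial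
open Summit.ValiantsHypothesis.ValiantsHypothesis.Theorems.BarrierLever.SuccinctHittingSetsForVP

/-- The Kabanets–Impagliazzo threshold of the tree's unconditional engine: with `N` coordinates,
intersection parameter `r`, base degree `δ` and `m` base variables,
`T(s, Δ) = (s + N (δ+1)^r (2δ+2) + Δ·max 1 δ + δ + m + 4)^7`.
[cite: KumarRamyaSaptharishiTengse2022, Lemma 8] -/
def kiThreshold (N r δ m : ℕ) : ℕ → ℕ → ℕ :=
  fun s Δ => (s + N * ((δ + 1) ^ r * (2 * δ + 2)) + Δ * max 1 δ + δ + m + 4) ^ 7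

/-- The KI threshold is monotone in (size, degree). [cite: KumarRamyaSaptharishiTengse2022, Lemma 8] -/
theorem kiThreshold_monotone (N r δ m : ℕ) : MonotoneThreshold (kiThreshold N r δ m) := by
  intro s s' Δ Δ' hs hΔ
  unfold kiThreshold
  gcongr

variable {F : Type*} [Field F] [CharZero F] {α β : Type*} [Fintype β] [DecidableEq β] [DecidableEq α]

/-- **Every KI design generator is reconstructible** (KI Lemma 30 / KRST Lemma 8 in the window's
vocabulary): over a field of characteristic zero, for an `r`-design `e : degLEMonomials n → (β ↪ α)`
and any `f ∈ F[β]`, `Reconstructible (kiGenerator f e) (L f) (kiThreshold N_n r (deg f) #β)`.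
[cite: KabanetsImpagliazzo2003, Lemma 30] -/
theorem reconstructible_kiGenerator {n r : ℕ} {e : degLEMonomials n → (β ↪ α)} (he : IsNWDesign r e)
    (f : MvPolynomial β F) :
    Reconstructible (kiGenerator f e) (complexity f)
      (kiThreshold (Fintype.card (degLEMonomials n)) r f.totalDegree (Fintype.card β)) :=
  fun _ hD hann => complexity_le_of_kiGenerator_annihilated he f hD hann

/-- **The equation edge for ALL Kabanets–Impagliazzo design generators.** For every succinctness
exponent `b` there are `c, n₀` such that for all `n ≥ n₀`, every design `e` (any block type, any
intersection parameter `r`) and every base polynomial `f` over `ℂ`: if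
`L(f) > kiThreshold N_n r (deg f) #β (2^{n^c}) (n^c)` — `f` is planted above the class's own equation
level — then `KI-gen(f)` is NOT per-seed `SmallCircuits ℂ n b`-succinct ("overplanting kills
succinctness"; with the lower edge `isHittingSetGenerator_of_reconstructible` this is the window
`window_smallCircuits` for the whole KI template). [cite: KumarRamyaSaptharishiTengse2022, Lemma 8] -/
theorem kiGenerator_not_succinct_of_overplanted (b : ℕ) : ∃ c n₀ : ℕ, ∀ n : ℕ, n₀ ≤ n →
    ∀ {α β : Type*} [Fintype β] [DecidableEq β] [DecidableEq α] (r : ℕ)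
      (e : degLEMonomials n → (β ↪ α)), IsNWDesign r e → ∀ f : MvPolynomial β ℂ,
      kiThreshold (Fintype.card (degLEMonomials n)) r f.totalDegree (Fintype.card β)
          (2 ^ (n ^ c)) (n ^ c) < complexity f →
      ¬ IsSuccinctGenerator (degLEMonomials n) (SmallCircuits ℂ n b) (kiGenerator f e) := by
  obtain ⟨c, n₀, h⟩ := not_succinct_smallCircuits_of_overplanted b
  refine ⟨c, n₀, fun n hn α β _ _ _ r e he f hover => ?_⟩
  exact h n hn (kiGenerator f e) (complexity f) _ (reconstructible_kiGenerator he f)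
    (kiThreshold_monotone _ _ _ _) hover

/-- The lower edge for the KI template, for the record: hardness above the KI threshold at level
`(N^a, N^a)` makes `KI-gen(f)` a hitting set generator for `Distinguishers F n a` (this is
`kiGenerator_isHittingSetGenerator` read through `isHittingSetGenerator_distinguishers_of_reconstructible`).
[cite: KumarRamyaSaptharishiTengse2022, Lemma 8] -/
theorem kiGenerator_isHittingSetGenerator_distinguishers {n r a : ℕ}
    {e : degLEMonomials n → (β ↪ α)} (he : IsNWDesign r e) (f : MvPolynomial β F)
    (hhard : kiThreshold (Fintype.card (degLEMonomials n)) r f.totalDegree (Fintype.card β)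
      ((Nat.choose (2 * n) n) ^ a) ((Nat.choose (2 * n) n) ^ a) < complexity f) :
    IsHittingSetGenerator (Distinguishers F n a) (kiGenerator f e) :=
  isHittingSetGenerator_distinguishers_of_reconstructible (reconstructible_kiGenerator he f)
    (kiThreshold_monotone _ _ _ _) hhard

end IdealWindow

end Summit.ValiantsHypothesis.ValiantsHypothesis.Theorems.BarrierLever.SuccinctHittingSetsForVP

end
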